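import Literature.NumberTheory.EllipticCurves.HeckeFixedPointCount
import Literature.NumberTheory.Automorphic.PopaZagierConjugationSums
import Mathlib.NumberTheory.ArithmeticFunction.Misc
import HarnessLib

/-!
# The split-hyperbolic and scalar part of `tr(T̃_n | ℚ[Γ₀(N)\SL₂(ℤ)])` (squarefree level)

Invariance of the fixed-point count `Fix_N(M)` (`fixCount`) under sign, `SL₂(ℤ)`-conjugation
and congruence modulo `N`, and the evaluation of the `H`-bracket of the Popa–Zagier element
against it: for squarefree `N` prime to `n > 0`,

  `∑_{det M = n} w_H(M) Fix_N(M) = 12 τ(N) ∑_{ad = n, a < d} (d − a) + 2 |X_N| [n = a²]`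

(`finsum_bw_wH_fixCount`), where `τ(N) = #{c ∣ N} = 2^{ω(N)}` is the number of cusps of `Γ₀(N)`
and `|X_N| = [SL₂(ℤ) : Γ₀(N)]`.  The key count is `∑_{b mod (d−a)} Fix_N((a b; 0 d)) = (d − a) τ(N)`
(`sum_fixCount_upper`), obtained from the periodicity of `b ↦ Fix_N((a b; 0 d))` modulo `d − a`
(conjugation by `T`) and modulo `N`, and the complete sum `∑_{b mod N} Fix_N((a b; 0 d)) = N τ(N)`
(Chinese remainder theorem on the product formula `fixCount_eq_prod`).

## References
* [Popa2014] A. Popa, Res. Math. Sci. 5 (2018), §2.2 (hyperbolic and scalar classes).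
* [PopaZagier2017] A. Popa, D. Zagier, arXiv:1711.00327, §4 (12).
-/

noncomputable section

open scoped MatrixGroups
open Matrix Literature.NumberTheory.Automorphic.PopaZagier

namespace Literature.NumberTheory.EllipticCurves.ModularForms

/-! ### Invariance of the fixed-point count -/

section Invariance

variable (N : ℕ) [NeZero N]

/-- `smulP1` only depends on the reduction modulo `N`. [folklore] -/
theorem smulP1_congr {M M' : Matrix (Fin 2) (Fin 2) ℤ} (h : redMat N M = redMat N M') :
    smulP1 N M = smulP1 N M' := by
  funext x
  induction x using P1.ind with
  | h v =>
    by_cases hM : IsUnit (redMat N M).det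
    · have hM' : IsUnit (redMat N M').det := h ▸ hM
      rw [smulP1_mk N hM, smulP1_mk N hM']
      congr 1
      apply Subtype.ext
      simp [UniCol.mulVec, h]
    · have hM' : ¬ IsUnit (redMat N M').det := h ▸ hM
      simp [smulP1, hM, hM']

/-- If `det M` is not a unit modulo `N`, every point is fixed (the action is trivial by
convention). [folklore] -/
theorem fixCount_of_not_isUnit {M : Matrix (Fin 2) (Fin 2) ℤ} (h : ¬ IsUnit (redMat N M).det) :
    fixCount N M = Nat.card (Gamma0Coset N) := by
  rw [fixCount_eq_card_P1]
  have : ∀ x : P1 N, smulP1 N M x = x := fun x => by simp [smulP1, h]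
  rw [Nat.card_congr (Equiv.subtypeUnivEquiv this)]
  exact Nat.card_congr (cosetEquivP1 N).symm

/-- `Fix_N(-M) = Fix_N(M)`. [folklore] -/
theorem fixCount_neg (M : Matrix (Fin 2) (Fin 2) ℤ) : fixCount N (-M) = fixCount N M := by
  by_cases hM : IsUnit ((M.det : ℤ) : ZMod N)
  · unfold fixCount
    have hadj : IsUnit (((adjugate M).det : ℤ) : ZMod N) := (cosetAction_actP N).adj hM
    have h : ∀ q, actP N q (adjugate (-M)) = actP N q (adjugate M) := fun q => by
      rw [adjugate_neg_two, (cosetAction_actP N).act_neg q hadj]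
    simp_rw [h]
  · have h1 : ¬ IsUnit (redMat N M).det := by rwa [isUnit_det_redMat_iff]
    have h2 : ¬ IsUnit (redMat N (-M)).det := by
      rw [isUnit_det_redMat_iff, Matrix.det_neg]; simpa using hM
    rw [fixCount_of_not_isUnit N h1, fixCount_of_not_isUnit N h2]

/-- **`Fix_N` is a class function**: `Fix_N(γ M γ⁻¹) = Fix_N(M)` for `γ ∈ SL₂(ℤ)`. [folklore] -/
theorem fixCount_conj (γ : SL(2, ℤ)) (M : Matrix (Fin 2) (Fin 2) ℤ) :
    fixCount N ((γ : Matrix (Fin 2) (Fin 2) ℤ) * M * ((γ⁻¹ : SL(2, ℤ)) : Matrix (Fin 2) (Fin 2) ℤ)) =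
      fixCount N M := by
  have hdet : ((γ : Matrix (Fin 2) (Fin 2) ℤ) * M * ((γ⁻¹ : SL(2, ℤ)) : Matrix (Fin 2) (Fin 2) ℤ)).det =
      M.det := by
    rw [Matrix.det_mul, Matrix.det_mul, γ.det_coe, (γ⁻¹).det_coe]; ring
  by_cases hM : IsUnit ((M.det : ℤ) : ZMod N)
  · unfold fixCount
    have hγ : IsUnit (((γ : Matrix (Fin 2) (Fin 2) ℤ).det : ℤ) : ZMod N) := by
      rw [γ.det_coe]; simp
    have hγ' : IsUnit ((((γ⁻¹ : SL(2, ℤ)) : Matrix (Fin 2) (Fin 2) ℤ).det : ℤ) : ZMod N) := by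
      rw [(γ⁻¹).det_coe]; simp
    have hadj : IsUnit (((adjugate M).det : ℤ) : ZMod N) := (cosetAction_actP N).adj hM
    have hadjγ : IsUnit (((adjugate (γ : Matrix (Fin 2) (Fin 2) ℤ)).det : ℤ) : ZMod N) :=
      (cosetAction_actP N).adj hγ
    have hadjγ' : IsUnit (((adjugate ((γ⁻¹ : SL(2, ℤ)) : Matrix (Fin 2) (Fin 2) ℤ)).det : ℤ) : ZMod N) :=
      (cosetAction_actP N).adj hγ'
    -- `adj (γ M γ⁻¹) = adj γ⁻¹ · adj M · adj γ = γ · adj M · γ⁻¹`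
    have hadj_eq : adjugate ((γ : Matrix (Fin 2) (Fin 2) ℤ) * M * ((γ⁻¹ : SL(2, ℤ)) : Matrix (Fin 2) (Fin 2) ℤ)) =
        adjugate ((γ⁻¹ : SL(2, ℤ)) : Matrix (Fin 2) (Fin 2) ℤ) * adjugate M *
          adjugate (γ : Matrix (Fin 2) (Fin 2) ℤ) := by
      rw [Matrix.adjugate_mul_distrib, Matrix.adjugate_mul_distrib, Matrix.mul_assoc]
    have h : ∀ q, actP N q (adjugate ((γ : Matrix (Fin 2) (Fin 2) ℤ) * M *
        ((γ⁻¹ : SL(2, ℤ)) : Matrix (Fin 2) (Fin 2) ℤ))) =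
        actP N (actP N (actP N q (adjugate ((γ⁻¹ : SL(2, ℤ)) : Matrix (Fin 2) (Fin 2) ℤ)))
          (adjugate M)) (adjugate (γ : Matrix (Fin 2) (Fin 2) ℤ)) := fun q => by
      rw [hadj_eq, ← (cosetAction_actP N).act_mul q (((cosetAction_actP N).mul hadjγ' hadj)) hadjγ,
        ← (cosetAction_actP N).act_mul q hadjγ' hadj]
    -- `adj γ⁻¹ = γ`, `adj γ = γ⁻¹` act as `γ⁻¹ •` and `γ •`
    have e1 : ∀ q, actP N q (adjugate ((γ⁻¹ : SL(2, ℤ)) : Matrix (Fin 2) (Fin 2) ℤ)) = γ⁻¹ • q := by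
      intro q
      rw [Matrix.SpecialLinearGroup.coe_inv, Matrix.adjugate_adjugate _ (by simp)]
      simp only [Fintype.card_fin]
      rw [show ((2 : ℕ) - 2 : ℕ) = 0 from rfl, pow_zero, one_smul, actP_coe]
    have e2 : ∀ q, actP N q (adjugate (γ : Matrix (Fin 2) (Fin 2) ℤ)) = γ • q := by
      intro q
      rw [← Matrix.SpecialLinearGroup.coe_inv, actP_coe, inv_inv]
    simp_rw [h, e1, e2]
    refine Nat.card_congr ((MulAction.toPerm (γ⁻¹ : SL(2, ℤ))).subtypeEquiv fun q => ?_)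
    simp only [MulAction.toPerm_apply]
    constructor
    · intro hq
      have := congrArg (fun x => γ⁻¹ • x) hq
      simpa [smul_smul] using this
    · intro hq
      rw [hq, smul_smul, mul_inv_cancel, one_smul]
  · have h1 : ¬ IsUnit (redMat N M).det := by rwa [isUnit_det_redMat_iff]
    have h2 : ¬ IsUnit (redMat N ((γ : Matrix (Fin 2) (Fin 2) ℤ) * M *
        ((γ⁻¹ : SL(2, ℤ)) : Matrix (Fin 2) (Fin 2) ℤ))).det := by
      rw [isUnit_det_redMat_iff, hdet]; exact hM
    rw [fixCount_of_not_isUnit N h1, fixCount_of_not_isUnit N h2]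

/-- `Fix_N` only depends on `M mod N`. [folklore] -/
theorem fixCount_congr {M M' : Matrix (Fin 2) (Fin 2) ℤ} (h : redMat N M = redMat N M') :
    fixCount N M = fixCount N M' := by
  rw [fixCount_eq_card_P1, fixCount_eq_card_P1, smulP1_congr N h]

/-- `Fix_N(S M S) = Fix_N(M)` (`S M S = -S M S⁻¹`). [folklore] -/
theorem fixCount_conjS (M : Matrix (Fin 2) (Fin 2) ℤ) : fixCount N (matS * M * matS) = fixCount N M := by
  have h : matS * M * matS = -(((ModularGroup.S : SL(2, ℤ)) : Matrix (Fin 2) (Fin 2) ℤ) * M *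
      ((ModularGroup.S⁻¹ : SL(2, ℤ)) : Matrix (Fin 2) (Fin 2) ℤ)) := by
    rw [Matrix.SpecialLinearGroup.coe_inv, ModularGroup.coe_S]
    unfold matS
    ext i j; fin_cases i <;> fin_cases j <;>
      simp [Matrix.adjugate_fin_two, Matrix.mul_apply, Fin.sum_univ_two, Matrix.vecMul, dotProduct]
  rw [h, fixCount_neg, fixCount_conj]

/-- `Fix_N(U M U²) = Fix_N(M)` (`U M U² = -U M U⁻¹`). [folklore] -/
theorem fixCount_conjU (M : Matrix (Fin 2) (Fin 2) ℤ) :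
    fixCount N (matU * M * (matU * matU)) = fixCount N M := by
  let U : SL(2, ℤ) := ⟨matU, by unfold matU; simp [Matrix.det_fin_two]⟩
  have hU : matU = ((U : SL(2, ℤ)) : Matrix (Fin 2) (Fin 2) ℤ) := rfl
  have hU2 : matU * matU = -(((U⁻¹ : SL(2, ℤ)) : Matrix (Fin 2) (Fin 2) ℤ)) := by
    rw [Matrix.SpecialLinearGroup.coe_inv]
    change matU * matU = -adjugate matU
    unfold matU
    ext i j; fin_cases i <;> fin_cases j <;>
      simp [Matrix.adjugate_fin_two, Matrix.mul_apply, Fin.sum_univ_two]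
  rw [hU2, Matrix.mul_neg, fixCount_neg, hU, fixCount_conj]

/-- `Fix_N((a, b + d - a; 0, d)) = Fix_N((a b; 0 d))` (conjugation by `T`). [folklore] -/
theorem fixCount_upper_add (a b d : ℤ) : fixCount N !![a, b + (d - a); 0, d] = fixCount N !![a, b; 0, d] := by
  have hT : ((ModularGroup.T : SL(2, ℤ)) : Matrix (Fin 2) (Fin 2) ℤ) * !![a, b; 0, d] *
      ((ModularGroup.T⁻¹ : SL(2, ℤ)) : Matrix (Fin 2) (Fin 2) ℤ) = !![a, b + (d - a); 0, d] := by
    rw [ModularGroup.coe_T, ModularGroup.coe_T_inv]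
    ext i j; fin_cases i <;> fin_cases j <;> simp [Matrix.mul_apply, Fin.sum_univ_two]; ring
  rw [← hT, fixCount_conj]

/-- `Fix_N((a, b + N; 0, d)) = Fix_N((a b; 0 d))`. [folklore] -/
theorem fixCount_upper_add_level (a b d : ℤ) : fixCount N !![a, b + N; 0, d] = fixCount N !![a, b; 0, d] := by
  apply fixCount_congr
  ext i j
  fin_cases i <;> fin_cases j <;> simp [redMat_apply]

end Invariance

/-! ### Sums over periods and the Chinese remainder theorem -/

section Sums

/-- A sum over `k` periods of a periodic function. [folklore] -/
theorem sum_range_mul_of_periodic {R : Type*} [AddCommMonoid R] (F : ℕ → R) {m : ℕ}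
    (hF : ∀ b, F (b + m) = F b) (k : ℕ) :
    ∑ b ∈ Finset.range (k * m), F b = k • ∑ b ∈ Finset.range m, F b := by
  induction k with
  | zero => simp
  | succ k ih =>
    rw [Nat.succ_mul, Finset.sum_range_add, ih, succ_nsmul]
    congr 1
    refine Finset.sum_congr rfl fun x _ => ?_
    have hper : Function.Periodic F m := hF
    have := hper.nat_mul k x
    simp only [Nat.cast_id] at this
    rw [add_comm]; exact this

/-- **Chinese remainder theorem for sums of products of local functions** over a squarefree
modulus: `∑_{r mod N} ∏_{ℓ ∣ N} h_ℓ(r mod ℓ) = ∏_{ℓ ∣ N} ∑_{s mod ℓ} h_ℓ(s)`. [folklore] -/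
theorem sum_range_prod_primeFactors {R : Type*} [CommSemiring R] :
    ∀ {N : ℕ}, Squarefree N → ∀ h : ℕ → ℕ → R,
      ∑ r ∈ Finset.range N, ∏ ℓ ∈ N.primeFactors, h ℓ (r % ℓ) =
        ∏ ℓ ∈ N.primeFactors, ∑ s ∈ Finset.range ℓ, h ℓ s := by
  intro N
  induction N using Nat.recOnPosPrimePosCoprime with
  | zero => exact fun h => absurd h not_squarefree_zero
  | one => intro _ h; simp
  | prime_pow p k hp hk =>
    intro hsq h
    have hk1 : k = 1 := by
      rcases (Nat.squarefree_pow_iff hp.ne_one hk.ne').mp hsq with ⟨-, h⟩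
      exact h
    subst hk1
    rw [pow_one, Nat.Prime.primeFactors hp]
    simp only [Finset.prod_singleton]
    exact Finset.sum_congr rfl fun r hr => by rw [Nat.mod_eq_of_lt (Finset.mem_range.mp hr)]
  | coprime m n hm hn hmn ihm ihn =>
    intro hsq h
    have hsqm : Squarefree m := (Nat.squarefree_mul_iff.mp hsq).2.1
    have hsqn : Squarefree n := (Nat.squarefree_mul_iff.mp hsq).2.2
    have hm0 : m ≠ 0 := by omega
    have hn0 : n ≠ 0 := by omega
    rw [Nat.Coprime.primeFactors_mul hmn]
    simp only [Finset.prod_union hmn.disjoint_primeFactors]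
    rw [← ihm hsqm h, ← ihn hsqn h, Finset.sum_mul_sum, ← Finset.sum_product']
    -- summands: `r % ℓ = (r % m) % ℓ` for `ℓ ∣ m`
    have hloc : ∀ r, (∏ ℓ ∈ m.primeFactors, h ℓ (r % ℓ)) * ∏ ℓ ∈ n.primeFactors, h ℓ (r % ℓ) =
        (∏ ℓ ∈ m.primeFactors, h ℓ (r % m % ℓ)) * ∏ ℓ ∈ n.primeFactors, h ℓ (r % n % ℓ) := by
      intro r
      congr 1
      · exact Finset.prod_congr rfl fun ℓ hℓ => by rw [Nat.mod_mod_of_dvd r (Nat.dvd_of_mem_primeFactors hℓ)]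
      · exact Finset.prod_congr rfl fun ℓ hℓ => by rw [Nat.mod_mod_of_dvd r (Nat.dvd_of_mem_primeFactors hℓ)]
    simp_rw [hloc]
    -- the bijection `r ↦ (r % m, r % n)`
    refine Finset.sum_nbij' (fun r => (r % m, r % n)) (fun q => (Nat.chineseRemainder hmn q.1 q.2 : ℕ))
      (fun r hr => ?_) (fun q hq => ?_) (fun r hr => ?_) (fun q hq => ?_) (fun r hr => rfl)
    · simp only [Finset.mem_product, Finset.mem_range]
      exact ⟨Nat.mod_lt _ (by omega), Nat.mod_lt _ (by omega)⟩
    · simp only [Finset.mem_range]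
      exact Nat.chineseRemainder_lt_mul hmn _ _ hm0 hn0
    · simp only [Finset.mem_range] at hr
      have h1 := Nat.chineseRemainder_modEq_unique hmn (a := r % m) (b := r % n) (z := r)
        (Nat.mod_modEq r m).symm (Nat.mod_modEq r n).symm
      exact (Nat.ModEq.eq_of_lt_of_lt h1 hr (Nat.chineseRemainder_lt_mul hmn _ _ hm0 hn0)).symm
    · simp only [Finset.mem_product, Finset.mem_range] at hq
      obtain ⟨q1, q2⟩ := q
      simp only at hq ⊢
      have h1 := (Nat.chineseRemainder hmn q1 q2).2
      refine Prod.ext ?_ ?_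
      · simp only
        rw [h1.1, Nat.mod_eq_of_lt hq.1]
      · simp only
        rw [h1.2, Nat.mod_eq_of_lt hq.2]

/-- `τ(N) = 2^{ω(N)}` for squarefree `N`. [folklore] -/
theorem card_divisors_of_squarefree : ∀ {N : ℕ}, Squarefree N → N.divisors.card = 2 ^ N.primeFactors.card := by
  intro N
  induction N using Nat.recOnPosPrimePosCoprime with
  | zero => exact fun h => absurd h not_squarefree_zero
  | one => intro; simp
  | prime_pow p k hp hk =>
    intro hsq
    have hk1 : k = 1 := by
      rcases (Nat.squarefree_pow_iff hp.ne_one hk.ne').mp hsq with ⟨-, h⟩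
      exact h
    subst hk1
    rw [pow_one, Nat.Prime.primeFactors hp, Finset.card_singleton, Nat.Prime.divisors hp,
      Finset.card_pair hp.ne_one.symm]
    rfl
  | coprime m n hm hn hmn ihm ihn =>
    intro hsq
    rw [Nat.Coprime.card_divisors_mul hmn, ihm (Nat.squarefree_mul_iff.mp hsq).2.1,
      ihn (Nat.squarefree_mul_iff.mp hsq).2.2, Nat.Coprime.primeFactors_mul hmn,
      Finset.card_union_of_disjoint hmn.disjoint_primeFactors, pow_add]

end Sums

/-! ### Upper triangular matrices: local factors and complete sums -/

section Upper

/-- The local factor of `(a b; 0 d)` at a prime `ℓ ∤ a d`… in fact for any prime `ℓ`: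
`(1 | 2) · (ℓ + 1 | 1)`. [folklore] -/
theorem localFix_upper {ℓ : ℕ} (hℓ : ℓ.Prime) (a b d : ℤ) :
    localFix ℓ !![a, b; 0, d] =
      (if (ℓ : ℤ) ∣ a - d then 1 else 2) * (if (ℓ : ℤ) ∣ b ∧ (ℓ : ℤ) ∣ a - d then ℓ + 1 else 1) := by
  haveI := Fact.mk hℓ
  unfold localFix
  simp only [Matrix.of_apply, Matrix.cons_val', Matrix.cons_val_zero, Matrix.cons_val_one,
    Matrix.cons_val_fin_one, Matrix.det_fin_two_of, dvd_zero, true_and]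
  congr 1
  rw [show ((a + d : ℤ) : ZMod ℓ) = (a : ZMod ℓ) + (d : ZMod ℓ) by push_cast; ring,
    show ((a * d - b * 0 : ℤ) : ZMod ℓ) = (a : ZMod ℓ) * (d : ZMod ℓ) by push_cast; ring,
    rootCount_split]
  have hiff : ((a : ZMod ℓ) = (d : ZMod ℓ)) ↔ (ℓ : ℤ) ∣ a - d := by
    rw [ZMod.intCast_eq_intCast_iff_dvd_sub, dvd_sub_comm]
  by_cases h : (ℓ : ℤ) ∣ a - d
  · rw [if_pos (hiff.mpr h), if_pos h]
  · rw [if_neg (mt hiff.mp h), if_neg h]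

/-- The local factor of `(a b; 0 d)` only depends on `b mod ℓ`. [folklore] -/
theorem localFix_upper_mod {ℓ : ℕ} (hℓ : ℓ.Prime) (a d : ℤ) (b : ℕ) :
    localFix ℓ !![a, (b : ℤ); 0, d] = localFix ℓ !![a, ((b % ℓ : ℕ) : ℤ); 0, d] := by
  rw [localFix_upper hℓ, localFix_upper hℓ]
  simp only [Int.natCast_dvd_natCast, Nat.dvd_mod_iff (dvd_refl ℓ)]

/-- **The local complete sum**: `∑_{s mod ℓ} localFix ℓ (a s; 0 d) = 2ℓ`. [folklore] -/
theorem sum_localFix_upper {ℓ : ℕ} (hℓ : ℓ.Prime) (a d : ℤ) :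
    ∑ s ∈ Finset.range ℓ, localFix ℓ !![a, (s : ℤ); 0, d] = 2 * ℓ := by
  simp_rw [localFix_upper hℓ]
  have hdvd : ∀ s ∈ Finset.range ℓ, ((ℓ : ℤ) ∣ (s : ℤ) ↔ s = 0) := fun s hs => by
    rw [Int.natCast_dvd_natCast]
    constructor
    · intro h
      exact Nat.eq_zero_of_dvd_of_lt h (Finset.mem_range.mp hs)
    · rintro rfl; exact dvd_zero _
  by_cases had : (ℓ : ℤ) ∣ a - d
  · simp only [had, and_true, if_true, one_mul]
    calc ∑ s ∈ Finset.range ℓ, (if (ℓ : ℤ) ∣ (s : ℤ) then ℓ + 1 else 1)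
        = ∑ s ∈ Finset.range ℓ, (1 + if s = 0 then ℓ else 0) :=
          Finset.sum_congr rfl fun s hs => by simp only [hdvd s hs]; split_ifs <;> omega
      _ = 2 * ℓ := by
          rw [Finset.sum_add_distrib, Finset.sum_const, Finset.card_range, smul_eq_mul, mul_one,
            Finset.sum_ite_eq' (Finset.range ℓ) 0 (fun _ => ℓ), if_pos (Finset.mem_range.mpr hℓ.pos)]
          ring
  · simp only [had, and_false, if_false, Finset.sum_const, Finset.card_range, smul_eq_mul]
    ring

end Upper

/-! ### The `H`-part of the trace -/

section Hpart

variable {N : ℕ} [NeZero N]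

/-- **The complete sum** `∑_{r mod N} Fix_N((a r; 0 d)) = 2^{ω(N)} N` (squarefree `N`,
`(ad, N) = 1`). [folklore] -/
theorem sum_fixCount_upper_level (hN : Squarefree N) (a d : ℤ) (hcop : IsCoprime (a * d) (N : ℤ)) :
    ∑ r ∈ Finset.range N, fixCount N !![a, (r : ℤ); 0, d] = 2 ^ N.primeFactors.card * N := by
  have h1 : ∀ r : ℕ, fixCount N !![a, (r : ℤ); 0, d] =
      ∏ ℓ ∈ N.primeFactors, localFix ℓ !![a, ((r % ℓ : ℕ) : ℤ); 0, d] := by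
    intro r
    rw [fixCount_eq_prod hN _ (by rw [Matrix.det_fin_two_of]; simpa using hcop)]
    exact Finset.prod_congr rfl fun ℓ hℓ => localFix_upper_mod (Nat.prime_of_mem_primeFactors hℓ) a d r
  simp_rw [h1]
  rw [sum_range_prod_primeFactors hN (fun ℓ s => localFix ℓ !![a, (s : ℤ); 0, d]),
    Finset.prod_congr rfl fun ℓ hℓ => sum_localFix_upper (Nat.prime_of_mem_primeFactors hℓ) a d,
    Finset.prod_mul_distrib, Finset.prod_const, Nat.prod_primeFactors_of_squarefree hN]

/-- **`∑_{b mod (d − a)} Fix_N((a b; 0 d)) = (d − a) 2^{ω(N)}`** (squarefree `N`, `(ad, N) = 1`,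
`d > a`): the summand has periods `d − a` (conjugation by `T`) and `N`. [cite: Popa2014, §2.2] -/
theorem sum_fixCount_upper (hN : Squarefree N) (a d : ℤ) (hcop : IsCoprime (a * d) (N : ℤ)) {m : ℕ}
    (hm : (m : ℤ) = d - a) :
    ∑ b ∈ Finset.range m, fixCount N !![a, (b : ℤ); 0, d] = m * 2 ^ N.primeFactors.card := by
  set F : ℕ → ℕ := fun b => fixCount N !![a, (b : ℤ); 0, d]
  have hperm : ∀ b, F (b + m) = F b := fun b => by
    simp only [F, Nat.cast_add, hm]; exact fixCount_upper_add N a b d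
  have hperN : ∀ b, F (b + N) = F b := fun b => by
    simp only [F, Nat.cast_add]; exact fixCount_upper_add_level N a b d
  have e1 := sum_range_mul_of_periodic F hperm N
  have e2 := sum_range_mul_of_periodic F hperN m
  rw [mul_comm] at e2
  rw [e2, sum_fixCount_upper_level hN a d hcop, smul_eq_mul, smul_eq_mul] at e1
  -- `N * ∑_{b<m} F = m * (2^ω N)`
  have hN0 : 0 < N := NeZero.pos N
  apply Nat.eq_of_mul_eq_mul_left hN0
  rw [← e1]; ring

/-- A scalar matrix fixes everything: `Fix_N(a·1) = |X_N|`. [folklore] -/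
theorem fixCount_scalar (a : ℤ) : fixCount N !![a, 0; 0, a] = Nat.card (Gamma0Coset N) := by
  by_cases ha : IsUnit (redMat N !![a, 0; 0, a]).det
  · rw [fixCount_eq_card_P1]
    have : ∀ x : P1 N, smulP1 N !![a, 0; 0, a] x = x := by
      intro x
      induction x using P1.ind with
      | h v =>
        rw [smulP1_mk N ha, P1.mk_eq_mk_iff]
        simp [UniCol.mulVec]
        ring
    rw [Nat.card_congr (Equiv.subtypeUnivEquiv this)]
    exact Nat.card_congr (cosetEquivP1 N).symm
  · exact fixCount_of_not_isUnit N ha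

/-- The `H`-bracket on an upper triangular matrix `(a b; 0 d)`, `a > 0`, `0 ≤ b ≤ d − a = m`:
`2` at the scalar matrix, `6` at the two ends `b ∈ {0, m}` of a chain of positive length, `12`
inside. [cite: PopaZagier2017, §4 (12)] -/
theorem wH_upper {a d : ℤ} (ha : 0 < a) {m : ℕ} (hm : (m : ℤ) = d - a) {b : ℕ} (hb : b ≤ m) :
    wH a b 0 d = if b = m then (if b = 0 then 2 else 6) else (if b = 0 then 6 else 12) := by
  unfold wH chainWeight3
  rw [if_pos ⟨rfl, ha⟩]
  have h1 : a - d ≤ -(b : ℤ) ∧ -(b : ℤ) ≤ 0 := by constructor <;> omega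
  rw [if_pos h1]
  by_cases hbm : b = m <;> by_cases hb0 : b = 0 <;> simp [hbm, hb0] <;> omega

/-- The weighted sum along a chain of positive length `m`:
`∑_{b=0}^{m} w_H F(b) = 12 ∑_{b<m} F(b)` when `F(m) = F(0)`. [folklore] -/
theorem sum_wH_chain {a d : ℤ} (ha : 0 < a) {m : ℕ} (hm : (m : ℤ) = d - a) (hm0 : 0 < m)
    (F : ℕ → ℚ) (hF : F m = F 0) :
    ∑ b ∈ Finset.range (m + 1), (wH a b 0 d : ℚ) * F b = 12 * ∑ b ∈ Finset.range m, F b := by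
  have hv : ∀ b ∈ Finset.range (m + 1), (wH a b 0 d : ℚ) * F b =
      (if b = m then (if b = 0 then 2 else 6) else (if b = 0 then 6 else 12) : ℚ) * F b := by
    intro b hb
    rw [wH_upper ha hm (Nat.lt_succ_iff.mp (Finset.mem_range.mp hb))]
    push_cast
    split_ifs <;> rfl
  obtain ⟨k, rfl⟩ : ∃ k, m = k + 1 := ⟨m - 1, by omega⟩
  rw [Finset.sum_congr rfl hv, Finset.sum_range_succ, Finset.sum_range_succ', Finset.sum_range_succ' F]
  have e1 : ∀ b ∈ Finset.range k,
      (if b + 1 = k + 1 then (if b + 1 = 0 then (2 : ℚ) else 6) else (if b + 1 = 0 then 6 else 12)) *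
        F (b + 1) = 12 * F (b + 1) := by
    intro b hb
    have := Finset.mem_range.mp hb
    rw [if_neg (by omega), if_neg (by omega)]
  rw [Finset.sum_congr rfl e1, ← Finset.mul_sum, if_neg (by omega : ¬ (0 : ℕ) = k + 1), if_pos rfl,
    if_pos rfl, if_neg (by omega : k + 1 ≠ 0), hF]
  ring

/-- The matrices carrying the `H`-bracket on `det = n`: `(a b; 0 n/a)` with `a ∣ n`, `a² ≤ n`,
`0 ≤ b ≤ n/a − a`. [cite: PopaZagier2017, §4 (12)] -/
def hIndex (n : ℕ) : Finset (ℕ × ℕ) :=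
  ((n.divisors.filter fun a => a * a ≤ n) ×ˢ Finset.range (n + 1)).filter fun p => p.2 + p.1 ≤ n / p.1

/-- The matrix `(a b; 0 n/a)`. [folklore] -/
def hMat (n : ℕ) (p : ℕ × ℕ) : Matrix (Fin 2) (Fin 2) ℤ := !![(p.1 : ℤ), (p.2 : ℤ); 0, ((n / p.1 : ℕ) : ℤ)]

/-- The support of `M ↦ w_H(M) [det M = n]` lies in the image of `hIndex n`. [folklore] -/
theorem exists_hMat_eq_of_bw_wH_ne_zero {n : ℕ} (hn : 0 < n) {M : Matrix (Fin 2) (Fin 2) ℤ}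
    (h : bw wH n M ≠ 0) : ∃ p ∈ hIndex n, hMat n p = M := by
  unfold bw at h
  split_ifs at h with hdet
  · have hw : wH (M 0 0) (M 0 1) (M 1 0) (M 1 1) ≠ 0 := by exact_mod_cast h
    obtain ⟨hc, ha, h1, h2⟩ := wH_ne_zero hw
    rw [Matrix.det_fin_two, hc, mul_zero, sub_zero] at hdet
    -- `a = M 0 0 > 0`, `d = M 1 1 = n / a`, `0 ≤ b = M 0 1 ≤ d - a`
    have hd : 0 < M 1 1 := by
      by_contra hd
      have : M 0 0 * M 1 1 ≤ 0 := mul_nonpos_of_nonneg_of_nonpos ha.le (not_lt.mp hd)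
      omega
    set a := (M 0 0).toNat with ha_def
    set b := (M 0 1).toNat with hb_def
    have haa : (a : ℤ) = M 0 0 := Int.toNat_of_nonneg ha.le
    have hbb : (b : ℤ) = M 0 1 := Int.toNat_of_nonneg (by omega)
    have hdvd : a ∣ n := by
      have : (a : ℤ) ∣ (n : ℤ) := ⟨M 1 1, by rw [haa, hdet]⟩
      exact_mod_cast this
    have ha0 : 0 < a := by omega
    have hdd : ((n / a : ℕ) : ℤ) = M 1 1 := by
      rw [Int.natCast_ediv, haa]
      exact (Int.eq_ediv_of_mul_eq_right ha.ne' hdet).symm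
    refine ⟨(a, b), ?_, ?_⟩
    · simp only [hIndex, Finset.mem_filter, Finset.mem_product, Nat.mem_divisors, Finset.mem_range]
      refine ⟨⟨⟨⟨hdvd, hn.ne'⟩, ?_⟩, ?_⟩, ?_⟩
      · -- `a² ≤ n`
        have : (a : ℤ) * a ≤ M 0 0 * M 1 1 := by rw [haa]; nlinarith
        rw [hdet] at this
        exact_mod_cast this
      · have : (b : ℤ) < n + 1 := by
          have : M 0 1 ≤ M 1 1 - M 0 0 := by omega
          have : M 1 1 ≤ M 0 0 * M 1 1 := by nlinarith
          omega
        exact_mod_cast this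
      · have : (b : ℤ) + a ≤ ((n / a : ℕ) : ℤ) := by rw [hdd, haa, hbb]; omega
        exact_mod_cast this
    · simp only [hMat]
      rw [hdd, haa, hbb]
      ext i j; fin_cases i <;> fin_cases j
      · rfl
      · rfl
      · exact hc.symm
      · rfl
  · exact absurd rfl h

/-- `hMat` is injective. [folklore] -/
theorem hMat_injective (n : ℕ) : Function.Injective (hMat n) := by
  intro p q h
  have h1 := congrFun (congrFun h 0) 0
  have h2 := congrFun (congrFun h 0) 1
  simp only [hMat, Matrix.of_apply, Matrix.cons_val', Matrix.cons_val_zero, Matrix.cons_val_one,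
    Matrix.cons_val_fin_one, Nat.cast_inj] at h1 h2
  exact Prod.ext h1 h2

/-- **The `H`-part of `tr(T̃_n | ℚ[X_N])`** for squarefree `N` prime to `n`:
`∑_{det M = n} w_H(M) Fix_N(M) = 12 · 2^{ω(N)} ∑_{a ∣ n, a² < n} (n/a − a) + 2 |X_N| [n = a²]`.
[cite: Popa2014, §2.2; PopaZagier2017, §4 (12)] -/
theorem finsum_bw_wH_fixCount (hN : Squarefree N) {n : ℕ} (hn : 0 < n) (hnN : n.Coprime N) :
    ∑ᶠ M, bw wH n M * (fixCount N M : ℚ) =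
      12 * 2 ^ N.primeFactors.card *
          (∑ a ∈ n.divisors.filter (fun a => a * a < n), (((n / a : ℕ) : ℚ) - a)) +
        (if IsSquare n then 2 * (Nat.card (Gamma0Coset N) : ℚ) else 0) := by
  -- Step A: parametrise the support
  have hsupp : Function.support (fun M => bw wH n M * (fixCount N M : ℚ)) ⊆
      ((hIndex n).image (hMat n) : Finset _) := by
    intro M hM
    rw [Function.mem_support] at hM
    have h1 : bw wH n M ≠ 0 := fun h => hM (by rw [h, zero_mul])
    obtain ⟨p, hp, rfl⟩ := exists_hMat_eq_of_bw_wH_ne_zero hn h1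
    exact Finset.mem_coe.mpr (Finset.mem_image_of_mem _ hp)
  rw [finsum_eq_sum_of_support_subset _ hsupp, Finset.sum_image fun p _ q _ h => hMat_injective n h]
  -- Step B: iterate the sum
  unfold hIndex
  rw [Finset.sum_filter, Finset.sum_product]
  -- Step C: the inner sums
  have hinner : ∀ a ∈ n.divisors.filter (fun a => a * a ≤ n),
      (∑ b ∈ Finset.range (n + 1),
        if b + a ≤ n / a then bw wH n (hMat n (a, b)) * (fixCount N (hMat n (a, b)) : ℚ) else 0) =
      if a * a = n then 2 * (Nat.card (Gamma0Coset N) : ℚ)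
        else 12 * 2 ^ N.primeFactors.card * (((n / a : ℕ) : ℚ) - a) := by
    intro a ha
    simp only [Finset.mem_filter, Nat.mem_divisors] at ha
    obtain ⟨⟨hdvd, -⟩, hsq⟩ := ha
    have ha0 : 0 < a := Nat.pos_of_dvd_of_pos hdvd hn
    set d := n / a with hd_def
    have had : a * d = n := Nat.mul_div_cancel' hdvd
    have hale : a ≤ d := by nlinarith
    set m := d - a with hm_def
    have hm : (m : ℤ) = (d : ℤ) - a := by rw [hm_def]; push_cast [hale]; ring
    -- restrict the range to `b ≤ m`
    rw [← Finset.sum_filter]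
    have hrange : (Finset.range (n + 1)).filter (fun b => b + a ≤ d) = Finset.range (m + 1) := by
      ext b
      simp only [Finset.mem_filter, Finset.mem_range]
      have : d ≤ n := Nat.div_le_self n a
      omega
    rw [hrange]
    -- the summand on the chain
    have hdet : ∀ b : ℕ, (hMat n (a, b)).det = n := fun b => by
      simp only [hMat, Matrix.det_fin_two_of, mul_zero, sub_zero]
      rw [← hd_def]; exact_mod_cast had
    have hbw : ∀ b : ℕ, bw wH n (hMat n (a, b)) = (wH a b 0 d : ℚ) := fun b => by
      unfold bw; rw [if_pos (hdet b)]; simp [hMat, ← hd_def]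
    simp_rw [hbw]
    have hcop : IsCoprime ((a : ℤ) * d) (N : ℤ) := by
      rw [show ((a : ℤ) * d) = (n : ℤ) by exact_mod_cast had, Nat.isCoprime_iff_coprime]; exact hnN
    by_cases hsq' : a * a = n
    · -- scalar: `m = 0`
      have hda : d = a := by
        have : a * d = a * a := by rw [had, hsq']
        exact Nat.eq_of_mul_eq_mul_left ha0 this
      have hm0 : m = 0 := by rw [hm_def, hda, Nat.sub_self]
      rw [if_pos hsq', hm0, Finset.sum_range_one,
        wH_upper (b := 0) (by exact_mod_cast ha0) hm (Nat.zero_le _)]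
      simp only [hm0, if_true]
      have : hMat n (a, 0) = !![(a : ℤ), 0; 0, (a : ℤ)] := by
        simp only [hMat, ← hd_def, hda, Nat.cast_zero]
      rw [this, fixCount_scalar]
      push_cast; ring
    · -- chain of positive length
      have hm0 : 0 < m := by
        rw [hm_def]
        have : a < d := lt_of_le_of_ne hale (fun h => hsq' (by rw [← had, ← h]))
        omega
      rw [if_neg hsq']
      have hF : (fixCount N (hMat n (a, m)) : ℚ) = fixCount N (hMat n (a, 0)) := by
        simp only [hMat, ← hd_def, Nat.cast_zero]
        have := fixCount_upper_add N (a : ℤ) 0 (d : ℤ)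
        rw [zero_add, ← hm] at this
        exact_mod_cast this
      rw [sum_wH_chain (by exact_mod_cast ha0) hm hm0 (fun b => (fixCount N (hMat n (a, b)) : ℚ)) hF]
      have hsum := sum_fixCount_upper hN (a : ℤ) (d : ℤ) hcop hm
      simp only [hMat, ← hd_def] at hsum ⊢
      rw [show (∑ b ∈ Finset.range m, (fixCount N !![(a : ℤ), (b : ℤ); 0, (d : ℤ)] : ℚ)) =
          ((∑ b ∈ Finset.range m, fixCount N !![(a : ℤ), (b : ℤ); 0, (d : ℤ)] : ℕ) : ℚ) by push_cast; rfl,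
        hsum]
      push_cast
      rw [Nat.cast_sub hale]
      ring
  rw [Finset.sum_congr rfl hinner, Finset.sum_ite, Finset.sum_const, Finset.mul_sum]
  -- the two filters
  have hf1 : (n.divisors.filter (fun a => a * a ≤ n)).filter (fun a => a * a = n) =
      n.divisors.filter (fun a => a * a = n) := by
    ext a; simp only [Finset.mem_filter]; constructor
    · rintro ⟨⟨h1, -⟩, h2⟩; exact ⟨h1, h2⟩
    · rintro ⟨h1, h2⟩; exact ⟨⟨h1, h2.le⟩, h2⟩
  have hf2 : (n.divisors.filter (fun a => a * a ≤ n)).filter (fun a => ¬ a * a = n) =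
      n.divisors.filter (fun a => a * a < n) := by
    ext a; simp only [Finset.mem_filter]; constructor
    · rintro ⟨⟨h1, h2⟩, h3⟩; exact ⟨h1, lt_of_le_of_ne h2 h3⟩
    · rintro ⟨h1, h2⟩; exact ⟨⟨h1, h2.le⟩, h2.ne⟩
  rw [hf1, hf2, add_comm]
  congr 1
  by_cases hsq : IsSquare n
  · obtain ⟨r, hr⟩ := hsq
    have : n.divisors.filter (fun a => a * a = n) = {r} := by
      ext a
      simp only [Finset.mem_filter, Nat.mem_divisors, Finset.mem_singleton]
      constructor
      · rintro ⟨-, h⟩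
        exact Nat.mul_self_inj.mp (by rw [h, hr])
      · intro h
        rw [h]
        exact ⟨⟨⟨r, hr⟩, hn.ne'⟩, hr.symm⟩
    rw [if_pos ⟨r, hr⟩, this, Finset.card_singleton, one_smul]
  · have : n.divisors.filter (fun a => a * a = n) = ∅ := by
      ext a
      simp only [Finset.mem_filter, Finset.notMem_empty, iff_false, not_and]
      exact fun _ h => hsq ⟨a, h.symm⟩
    rw [if_neg hsq, this, Finset.card_empty, zero_smul]

end Hpart

end Literature.NumberTheory.EllipticCurves.ModularForms

end
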